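import Mathlib
import Literature.NumberTheory.Transcendental.GammaMonomialsProofs

/-!
# SoloBlind — the immortal torsion Γ-relations are TRUE identities (kernel form, via Deligne 1982 Thm. 7.18 (a))

Companion of `SoloBlindLevel52` (class `α₅₂`), `SoloBlindLevelRaising44` / `SoloBlindLevel132` (class `α₄₄`),
`SoloBlindLevelRaising35` / `SoloBlindLevelRaising105` (class `a₃₅`) and `SoloBlindFermatExceptional33` /
`SoloBlindZ33Outright` (class `a₃₃`) of the solo-blind programme on the Kontsevich–Zagier conjecture
(`paper/hafnian-theorem.md` §11, THEOREM Z⁺⁺; `paper/CERTIFICATE.md` §3f, typed wall W5‴).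

Those files certify the NON-DERIVABILITY half: the listed Koblitz–Ogus units are not generated, at the stated
levels, by reflection, Gauss multiplication and the two-term Beta coincidences (the one-level Fermat/Beta
sub-calculus of the three Kontsevich–Zagier rules).  This file certifies the TRUTH half in the kernel: each of
them is a genuine identity "Γ-monomial = algebraic number × power of `2πi`", by the tree's sorry-free proof of
Deligne's theorem on Γ-monomials of Hodge type (LNM 900, Thm. 7.18 (a), first clause; Koblitz–Ogus road),
`Literature.NumberTheory.Transcendental.deligne_gammaMonomial_algebraic_holds`.

* `isHodgeType_of_koSum` — the bridge: the Hodge-type (Koblitz–Ogus) condition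
  `∀ u ⊥ d, Σ_{0<i<d} n_i {u i/d} = c` follows from the finitely many integer identities
  `Σ_{0<i<d} n_i · (u i mod d) = c·d`, `u < d` coprime to `d` (decidable, checked by `decide`).
* `gamma35_algebraic`  : `Γ(1/35)Γ(3/35)Γ(8/35)Γ(10/35) / (Γ(2/35)Γ(4/35)Γ(7/35)Γ(9/35)) ∈ ℚ̄` (class `a₃₅`, `c = 0`).
* `gamma33_algebraic`  : `Γ(2/33)Γ(8/33)Γ(11/33) / (Γ(1/33)Γ(4/33)Γ(16/33)) ∈ ℚ̄` (class `a₃₃`, `c = 0`).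
* `gamma52_algebraic`  : `(2πi)⁻¹ · Γ(3/52)Γ(7/52)Γ(11/52)Γ(27/52)Γ(30/52) / (Γ(5/52)Γ(9/52)Γ(12/52)) ∈ ℚ̄`
  (class `α₅₂`, `c = 1`).
* `gamma44_algebraic`  : `Γ(3/44)Γ(7/44)Γ(11/44)Γ(22/44) / (Γ(5/44)Γ(8/44)Γ(9/44)Γ(21/44)) ∈ ℚ̄` (class `α₄₄`:
  the unit `v44` of `SoloBlindLevelRaising44` has Koblitz–Ogus sums `-22`, i.e. half-integral `c = -1/2`;
  multiplying by `Γ(22/44) = Γ(1/2) = √π` gives the Hodge-type monomial with `c = 0` certified here), and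
  `gamma44_sq_algebraic` : `(2πi) · v44² ∈ ℚ̄` (the same fact without the auxiliary factor).

No new axioms: everything is `decide` plus the Literature theorem.
-/

namespace Summit.KontsevichZagierPeriods.KontsevichZagierPeriods.Theorems
namespace SoloBlind
namespace GammaValues

open Literature.NumberTheory.Transcendental

/-- A Γ-monomial of level `N` as a list of (index, exponent) pairs (same encoding as `SoloBlindLevel52`). -/
abbrev GammaMonomial := List (ℕ × ℤ)

/-- The exponent function `i ↦ n_i` of a Γ-monomial (repeated indices add up). -/
def coeffOf (e : GammaMonomial) (i : ℕ) : ℤ :=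
  (e.map fun kc => if kc.1 = i then kc.2 else 0).sum

/-- **Bridge lemma.** The Hodge-type condition of `IsHodgeTypeGammaMonomial d n c` (fractional parts, all
`u` coprime to `d`) follows from the integer identities `Σ_{0<i<d} n_i (u i mod d) = c d` for the units
`u < d`. [this work] -/
theorem isHodgeType_of_koSum {d : ℕ} (hd : 0 < d) (n : ℕ → ℤ) (c : ℤ)
    (h : ∀ u < d, Nat.Coprime u d →
      ∑ i ∈ Finset.Ico 1 d, n i * (((u * i) % d : ℕ) : ℤ) = c * d) :
    IsHodgeTypeGammaMonomial d n c := by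
  intro u hu
  have hd' : (d : ℚ) ≠ 0 := by exact_mod_cast hd.ne'
  have hcop : Nat.Coprime (u % d) d := by
    have : Nat.gcd (u % d) d = Nat.gcd d u := (Nat.gcd_rec d u).symm
    rw [Nat.Coprime, this]
    exact Nat.Coprime.symm hu
  have key := h (u % d) (Nat.mod_lt u hd) hcop
  have hfr : ∀ i ∈ Finset.Ico 1 d,
      (n i : ℚ) * Int.fract ((u : ℚ) * i / d) = ((n i * (((u % d * i) % d : ℕ) : ℤ) : ℤ) : ℚ) / (d : ℚ) := by
    intro i _
    have hq : ((u : ℚ) * i / d) = ((u * i : ℕ) : ℚ) / d := by push_cast; ring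
    have hmod : u * i % d = u % d * i % d := by
      conv_rhs => rw [Nat.mul_mod, Nat.mod_mod]
      exact Nat.mul_mod u i d
    rw [hq, Int.fract_div_natCast_eq_div_natCast_mod, hmod, Int.cast_mul, Int.cast_natCast]
    ring
  rw [Finset.sum_congr rfl hfr, ← Finset.sum_div, ← Int.cast_sum, key, Int.cast_mul, Int.cast_natCast]
  field_simp

/-- `a₃₅`: `v35 = e₁ - e₂ + e₃ - e₄ - e₇ + e₈ - e₉ + e₁₀` (as in `SoloBlindLevelRaising35`). -/
def v35 : GammaMonomial := [(1, 1), (2, -1), (3, 1), (4, -1), (7, -1), (8, 1), (9, -1), (10, 1)]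

/-- `a₃₃`: `v33 = -e₁ + e₂ - e₄ + e₈ + e₁₁ - e₁₆` (as in `SoloBlindFermatExceptional33`). -/
def v33 : GammaMonomial := [(1, -1), (2, 1), (4, -1), (8, 1), (11, 1), (16, -1)]

/-- `α₅₂`: `v52 = e₃ - e₅ + e₇ - e₉ + e₁₁ - e₁₂ + e₂₇ + e₃₀` (as in `SoloBlindLevel52`). -/
def v52 : GammaMonomial := [(3, 1), (5, -1), (7, 1), (9, -1), (11, 1), (12, -1), (27, 1), (30, 1)]

/-- `α₄₄`: `v44 = e₃ - e₅ + e₇ - e₈ - e₉ + e₁₁ - e₂₁` (as in `SoloBlindLevelRaising44`, `SoloBlindLevel132`). -/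
def v44 : GammaMonomial := [(3, 1), (5, -1), (7, 1), (8, -1), (9, -1), (11, 1), (21, -1)]

/-- `v44 + e₂₂`: the Hodge-type (integral `c = 0`) representative of `α₄₄`, `Γ(22/44) = √π`. -/
def v44h : GammaMonomial := v44 ++ [(22, 1)]

/-- `2·v44`: the square of `v44`, Hodge type with `c = -1`. -/
def v44sq : GammaMonomial := v44.map fun kc => (kc.1, 2 * kc.2)

/-- Koblitz–Ogus sums of `v35` at level 35: all `0`. -/
theorem ko35 : ∀ u < 35, Nat.Coprime u 35 →
    ∑ i ∈ Finset.Ico 1 35, coeffOf v35 i * (((u * i) % 35 : ℕ) : ℤ) = 0 * 35 := by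
  decide +kernel

/-- Koblitz–Ogus sums of `v33` at level 33: all `0`. -/
theorem ko33 : ∀ u < 33, Nat.Coprime u 33 →
    ∑ i ∈ Finset.Ico 1 33, coeffOf v33 i * (((u * i) % 33 : ℕ) : ℤ) = 0 * 33 := by
  decide +kernel

/-- Koblitz–Ogus sums of `v52` at level 52: all `52`. -/
theorem ko52 : ∀ u < 52, Nat.Coprime u 52 →
    ∑ i ∈ Finset.Ico 1 52, coeffOf v52 i * (((u * i) % 52 : ℕ) : ℤ) = 1 * 52 := by
  decide +kernel

/-- Koblitz–Ogus sums of `v44 + e₂₂` at level 44: all `0`. -/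
theorem ko44h : ∀ u < 44, Nat.Coprime u 44 →
    ∑ i ∈ Finset.Ico 1 44, coeffOf v44h i * (((u * i) % 44 : ℕ) : ℤ) = 0 * 44 := by
  decide +kernel

/-- Koblitz–Ogus sums of `2·v44` at level 44: all `-44`. -/
theorem ko44sq : ∀ u < 44, Nat.Coprime u 44 →
    ∑ i ∈ Finset.Ico 1 44, coeffOf v44sq i * (((u * i) % 44 : ℕ) : ℤ) = (-1) * 44 := by
  decide +kernel

/-- **`a₃₅` is a true identity**: `∏_{0<i<35} Γ(i/35)^{(v35)_i} ∈ ℚ̄`. [this work; Deligne 1982 Thm. 7.18 (a)] -/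
theorem gamma35_algebraic :
    IsAlgebraic ℚ (∏ i ∈ Finset.Ico (1 : ℕ) 35, ((Real.Gamma ((i : ℝ) / 35) : ℂ)) ^ (coeffOf v35 i)) := by
  simpa [gammaTilde] using deligne_gammaMonomial_algebraic_holds 35 (coeffOf v35) 0 (by norm_num)
    (isHodgeType_of_koSum (by norm_num) _ _ ko35)

/-- **`a₃₃` is a true identity**: `∏_{0<i<33} Γ(i/33)^{(v33)_i} ∈ ℚ̄`. [this work; Deligne 1982 Thm. 7.18 (a)] -/
theorem gamma33_algebraic :
    IsAlgebraic ℚ (∏ i ∈ Finset.Ico (1 : ℕ) 33, ((Real.Gamma ((i : ℝ) / 33) : ℂ)) ^ (coeffOf v33 i)) := by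
  simpa [gammaTilde] using deligne_gammaMonomial_algebraic_holds 33 (coeffOf v33) 0 (by norm_num)
    (isHodgeType_of_koSum (by norm_num) _ _ ko33)

/-- **`α₅₂` is a true identity**: `(2πi)⁻¹ ∏_{0<i<52} Γ(i/52)^{(v52)_i} ∈ ℚ̄`. [this work; Deligne 1982 Thm. 7.18 (a)] -/
theorem gamma52_algebraic : IsAlgebraic ℚ (gammaTilde 52 (coeffOf v52) 1) :=
  deligne_gammaMonomial_algebraic_holds 52 (coeffOf v52) 1 (by norm_num)
    (isHodgeType_of_koSum (by norm_num) _ _ ko52)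

/-- **`α₄₄` is a true identity** (Hodge-type representative): `∏_{0<i<44} Γ(i/44)^{(v44 + e₂₂)_i} ∈ ℚ̄`.
[this work; Deligne 1982 Thm. 7.18 (a)] -/
theorem gamma44_algebraic :
    IsAlgebraic ℚ (∏ i ∈ Finset.Ico (1 : ℕ) 44, ((Real.Gamma ((i : ℝ) / 44) : ℂ)) ^ (coeffOf v44h i)) := by
  simpa [gammaTilde] using deligne_gammaMonomial_algebraic_holds 44 (coeffOf v44h) 0 (by norm_num)
    (isHodgeType_of_koSum (by norm_num) _ _ ko44h)

/-- **`α₄₄` squared**: `(2πi) · ∏_{0<i<44} Γ(i/44)^{2 (v44)_i} ∈ ℚ̄`. [this work; Deligne 1982 Thm. 7.18 (a)] -/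
theorem gamma44_sq_algebraic : IsAlgebraic ℚ (gammaTilde 44 (coeffOf v44sq) (-1)) :=
  deligne_gammaMonomial_algebraic_holds 44 (coeffOf v44sq) (-1) (by norm_num)
    (isHodgeType_of_koSum (by norm_num) _ _ ko44sq)

end GammaValues
end SoloBlind
end Summit.KontsevichZagierPeriods.KontsevichZagierPeriods.Theorems
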